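import Literature.Analysis.OperatorTheory.SimilarityHeatSemigroupFourier
import Literature.Analysis.OperatorTheory.LpDilationContinuity
import Literature.Analysis.UnboundedOperators.StrongContRepresentation
import Mathlib.MeasureTheory.Integral.Lebesgue.DominatedConvergence
import HarnessLib

/-!
# The similarity heat semigroup (Fourier side) is a C₀-semigroup on `L^p`
  (Jia–Šverák 2015, Lemma 2.1: strong continuity, growth bound `e^{−τ/4}` on `L²(ℝ³)`)

Analysis/OperatorTheory file (one definition with body — the bundled `C0Semigroup` —,
everything proved, no named facts), completing `SimilarityHeatSemigroupFourier.lean`: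

* `continuous_lpMul_apply`: multiplication operators `lpMul (w x)` by a family of uniformly
  bounded scalar functions depending continuously on a parameter act **strongly continuously**
  (dominated convergence on `∫ ‖(w_x − w_{x₀}) h‖^p`);
* `continuous_fourierSimilarityHeat_apply`: **`τ ↦ M_τ f` is continuous** for every
  `f ∈ L^p(V; F)` (product of the strongly continuous bounded families `lpMul (w_τ)` and
  `D_{e^{−τ/2}}`, `LpDilationContinuity.lean`);
* `fourierSimilarityHeatSemigroup hp : C0Semigroup ℂ (Lp F p)` (**definition**): the bundled
  strongly continuous semigroup (`T(0) = 1`, `T(s + t) = T(s)T(t)` from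
  `fourierSimilarityHeat_zero/_add`), with `app` unfolding and the growth bound
  `‖T(τ)‖ ≤ 1 · e^{ωτ}`, `ω = (1 − d)/2 + d/(2p)` (`= −¼` for `p = 2`, `d = 3`) in the exact
  shape consumed by the Laplace bridge `C0Semigroup.laplaceResolvent` /
  `isPseudoResolvent_laplaceResolvent` / `operatorOfResolvent_laplaceResolvent_eq_generator`
  (`Literature.Analysis.UnboundedOperators.SemigroupLaplaceResolvent*`): the resolvent of its
  generator is a pseudo-resolvent on `{Re λ > ω}` — Jia–Šverák's `ρ(𝓛) ⊇ {Re λ > −¼}`.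

## References

* H. Jia, V. Šverák, J. Funct. Anal. 268 (2015), §2 Lemma 2.1. [JiaSverak2015]
* K.-J. Engel, R. Nagel, *One-Parameter Semigroups* (2000), Ch. I Def. 5.1, Ch. II Thm. 1.10.
  [EngelNagel2000]
-/

noncomputable section

open MeasureTheory Filter Topology Set
open scoped ENNReal NNReal

namespace Literature.Analysis.OperatorTheory

variable {V : Type*} [NormedAddCommGroup V] [InnerProductSpace ℝ V] [FiniteDimensional ℝ V]
  [MeasurableSpace V] [BorelSpace V]
variable {F : Type*} [NormedAddCommGroup F] [NormedSpace ℂ F]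
variable {p : ℝ≥0∞} [Fact (1 ≤ p)]

/-! ### Strong continuity of parametrised multiplication operators -/

/-- **Dominated convergence for multiplication operators**: if `x ↦ w x k` is continuous for
every `k`, each `w x` is measurable with `‖w x k‖ ≤ C x`, and `C` is continuous, then
`x ↦ lpMul (w x) h` is continuous for every `h ∈ L^p` (`p < ∞`). [folklore] -/
theorem continuous_lpMul_apply {X : Type*} [TopologicalSpace X] [FirstCountableTopology X]
    (hp : p ≠ ∞) {w : X → V → ℂ} (hw_cont : ∀ k, Continuous fun x => w x k)
    (hw_meas : ∀ x, Measurable (w x)) {C : X → ℝ} (hC : ∀ x k, ‖w x k‖ ≤ C x)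
    (hCc : Continuous C) (h : Lp F p (volume : Measure V)) :
    Continuous fun x => lpMul (w x) (hw_meas x) (C x) (hC x) h := by
  have hp0 : p ≠ 0 := (zero_lt_one.trans_le (Fact.out : 1 ≤ p)).ne'
  have hpr : 0 < p.toReal := ENNReal.toReal_pos hp0 hp
  refine continuous_iff_continuousAt.2 fun x₀ => ?_
  rw [ContinuousAt, tendsto_iff_norm_sub_tendsto_zero]
  -- the norm of the difference as an `L^p` integral of `(w x − w x₀) • h`
  have heq : ∀ x, ‖lpMul (w x) (hw_meas x) (C x) (hC x) h -
      lpMul (w x₀) (hw_meas x₀) (C x₀) (hC x₀) h‖ =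
      ((∫⁻ k, ‖(w x k - w x₀ k) • (h : V → F) k‖ₑ ^ p.toReal ∂(volume : Measure V)) ^
        (1 / p.toReal)).toReal := by
    intro x
    rw [Lp.norm_def, ← eLpNorm_eq_lintegral_rpow_enorm_toReal hp0 hp]
    congr 1
    refine eLpNorm_congr_ae ?_
    filter_upwards [Lp.coeFn_sub (lpMul (w x) (hw_meas x) (C x) (hC x) h)
        (lpMul (w x₀) (hw_meas x₀) (C x₀) (hC x₀) h),
      lpMul_coeFn (hw_meas x) (hC x) h, lpMul_coeFn (hw_meas x₀) (hC x₀) h] with k h1 h2 h3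
    rw [h1, Pi.sub_apply, h2, h3, sub_smul]
  simp_rw [heq]
  -- dominated convergence for the inner integral
  have hnear : ∀ᶠ x in 𝓝 x₀, C x < C x₀ + 1 :=
    (hCc.tendsto x₀).eventually (gt_mem_nhds (by linarith))
  have hC0 : 0 ≤ C x₀ := (norm_nonneg _).trans (hC x₀ 0)
  set B : ℝ := C x₀ + 1 + C x₀ with hB
  have hlim : Tendsto (fun x => ∫⁻ k, ‖(w x k - w x₀ k) • (h : V → F) k‖ₑ ^ p.toReal
      ∂(volume : Measure V)) (𝓝 x₀) (𝓝 0) := by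
    have h0 : (∫⁻ k, ‖(w x₀ k - w x₀ k) • (h : V → F) k‖ₑ ^ p.toReal ∂(volume : Measure V)) = 0 := by
      simp [hpr]
    rw [← h0]
    refine tendsto_lintegral_filter_of_dominated_convergence'
      (fun k => ENNReal.ofReal B ^ p.toReal * ‖(h : V → F) k‖ₑ ^ p.toReal) ?_ ?_ ?_ ?_
    · refine Eventually.of_forall fun x => ?_
      exact (((hw_meas x).sub (hw_meas x₀)).aestronglyMeasurable.smul
        (Lp.memLp h).aestronglyMeasurable).enorm.pow_const _
    · filter_upwards [hnear] with x hx
      refine Eventually.of_forall fun k => ?_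
      rw [← ENNReal.mul_rpow_of_nonneg _ _ hpr.le]
      refine ENNReal.rpow_le_rpow ?_ hpr.le
      rw [enorm_smul]
      refine mul_le_mul_left ?_ _
      rw [← ofReal_norm]
      refine ENNReal.ofReal_le_ofReal ?_
      calc ‖w x k - w x₀ k‖ ≤ ‖w x k‖ + ‖w x₀ k‖ := norm_sub_le _ _
        _ ≤ C x + C x₀ := add_le_add (hC x k) (hC x₀ k)
        _ ≤ B := by rw [hB]; linarith
    · rw [lintegral_const_mul' _ _ (ENNReal.rpow_ne_top_of_nonneg hpr.le ENNReal.ofReal_ne_top)]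
      exact ENNReal.mul_ne_top (ENNReal.rpow_ne_top_of_nonneg hpr.le ENNReal.ofReal_ne_top)
        (lintegral_rpow_enorm_lt_top_of_eLpNorm_lt_top hp0 hp (Lp.memLp h).eLpNorm_lt_top).ne
    · refine Eventually.of_forall fun k => ?_
      have hc : Continuous fun x => ‖(w x k - w x₀ k) • (h : V → F) k‖ₑ ^ p.toReal :=
        ENNReal.continuous_rpow_const.comp
          (continuous_enorm.comp (((hw_cont k).sub continuous_const).smul continuous_const))
      simpa using hc.tendsto x₀
  have h2 : Tendsto (fun x => ((∫⁻ k, ‖(w x k - w x₀ k) • (h : V → F) k‖ₑ ^ p.toReal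
      ∂(volume : Measure V)) ^ (1 / p.toReal)).toReal) (𝓝 x₀) (𝓝 ((0 : ℝ≥0∞) ^ (1 / p.toReal)).toReal) :=
    (ENNReal.tendsto_toReal (by simp [hpr.le])).comp
      ((ENNReal.continuous_rpow_const.tendsto 0).comp hlim)
  rwa [ENNReal.zero_rpow_of_pos (by positivity), ENNReal.toReal_zero] at h2

/-! ### Strong continuity of the similarity heat semigroup -/

omit [FiniteDimensional ℝ V] [MeasurableSpace V] [BorelSpace V] [Fact (1 ≤ p)] in
/-- Joint continuity of the weight in `τ` (for fixed `k`). [folklore] -/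
theorem continuous_similarityWeight_left (k : V) :
    Continuous fun τ : ℝ≥0 => (similarityWeight (τ : ℝ) k : ℂ) := by
  refine Complex.continuous_ofReal.comp ?_
  unfold similarityWeight
  fun_prop

/-- **`τ ↦ M_τ f` is continuous** for every `f ∈ L^p(V; F)`, `1 ≤ p < ∞`.
[cite: JiaSverak2015, §2 Lemma 2.1] -/
theorem continuous_fourierSimilarityHeat_apply (hp : p ≠ ∞) (f : Lp F p (volume : Measure V)) :
    Continuous fun τ : ℝ≥0 => fourierSimilarityHeat hp τ f := by
  -- the two strongly continuous factors
  set D : ℝ≥0 → Lp F p (volume : Measure V) := fun τ =>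
    lpDilation (Real.exp (-(τ : ℝ) / 2)) (Real.exp_pos _).ne' hp f with hD
  have hDc : Continuous D :=
    (continuous_lpDilation_apply hp f (a := fun τ : ℝ => Real.exp (-τ / 2)) (by fun_prop)
      (fun τ => (Real.exp_pos _).ne')).comp NNReal.continuous_coe
  set G : ℝ≥0 → (Lp F p (volume : Measure V) →L[ℂ] Lp F p (volume : Measure V)) := fun τ =>
    lpMul (fun k => (similarityWeight (τ : ℝ) k : ℂ)) (measurable_similarityWeight_ofReal τ)
      (Real.exp ((1 - Module.finrank ℝ V) * (τ : ℝ) / 2)) (norm_similarityWeight_ofReal_le τ)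
    with hG
  have hGc : ∀ h : Lp F p (volume : Measure V), Continuous fun τ => G τ h := fun h =>
    continuous_lpMul_apply (X := ℝ≥0) hp (w := fun (τ : ℝ≥0) k => (similarityWeight (τ : ℝ) k : ℂ))
      continuous_similarityWeight_left (fun τ => measurable_similarityWeight_ofReal (τ : ℝ))
      (C := fun τ : ℝ≥0 => Real.exp ((1 - Module.finrank ℝ V) * (τ : ℝ) / 2))
      norm_similarityWeight_ofReal_le (by fun_prop) h
  have hGbound : ∀ τ : ℝ≥0, ‖G τ‖ ≤ max (Real.exp ((1 - Module.finrank ℝ V) * (τ : ℝ) / 2)) 0 :=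
    fun τ => norm_lpMul_le _ _
  -- `M_τ f = G τ (D τ)`
  have hM : (fun τ : ℝ≥0 => fourierSimilarityHeat hp τ f) = fun τ => G τ (D τ) := by
    funext τ; rfl
  rw [hM]
  refine continuous_iff_continuousAt.2 fun τ₀ => ?_
  rw [ContinuousAt, tendsto_iff_norm_sub_tendsto_zero]
  -- `G τ (D τ) − G τ₀ (D τ₀) = G τ (D τ − D τ₀) + (G τ (D τ₀) − G τ₀ (D τ₀))`
  have hsplit : ∀ τ : ℝ≥0, ‖G τ (D τ) - G τ₀ (D τ₀)‖ ≤
      max (Real.exp ((1 - Module.finrank ℝ V) * (τ : ℝ) / 2)) 0 * ‖D τ - D τ₀‖ +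
        ‖G τ (D τ₀) - G τ₀ (D τ₀)‖ := by
    intro τ
    calc ‖G τ (D τ) - G τ₀ (D τ₀)‖ = ‖G τ (D τ - D τ₀) + (G τ (D τ₀) - G τ₀ (D τ₀))‖ := by
          rw [map_sub]; abel_nf
      _ ≤ ‖G τ (D τ - D τ₀)‖ + ‖G τ (D τ₀) - G τ₀ (D τ₀)‖ := norm_add_le _ _
      _ ≤ _ := by
          refine add_le_add ?_ le_rfl
          exact ((G τ).le_opNorm _).trans (mul_le_mul_of_nonneg_right (hGbound τ) (norm_nonneg _))
  have hlim : Tendsto (fun τ : ℝ≥0 => max (Real.exp ((1 - Module.finrank ℝ V) * (τ : ℝ) / 2)) 0 *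
      ‖D τ - D τ₀‖ + ‖G τ (D τ₀) - G τ₀ (D τ₀)‖) (𝓝 τ₀) (𝓝 0) := by
    have h1 : Tendsto (fun τ : ℝ≥0 => ‖D τ - D τ₀‖) (𝓝 τ₀) (𝓝 0) := by
      rw [← tendsto_iff_norm_sub_tendsto_zero]; exact hDc.tendsto τ₀
    have h2 : Tendsto (fun τ : ℝ≥0 => ‖G τ (D τ₀) - G τ₀ (D τ₀)‖) (𝓝 τ₀) (𝓝 0) := by
      rw [← tendsto_iff_norm_sub_tendsto_zero]; exact (hGc (D τ₀)).tendsto τ₀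
    have h3 : Tendsto (fun τ : ℝ≥0 => max (Real.exp ((1 - Module.finrank ℝ V) * (τ : ℝ) / 2)) 0)
        (𝓝 τ₀) (𝓝 (max (Real.exp ((1 - Module.finrank ℝ V) * (τ₀ : ℝ) / 2)) 0)) :=
      (Continuous.tendsto (by fun_prop) τ₀)
    simpa using (h3.mul h1).add h2
  exact squeeze_zero (fun τ => norm_nonneg _) hsplit hlim

/-! ### The C₀-semigroup -/

/-- **The similarity heat semigroup on the Fourier side as a C₀-semigroup** on `L^p(V; F)`,
`1 ≤ p < ∞` (Jia–Šverák 2015, Lemma 2.1: "`e^{τ𝓛}` is a strongly continuous semigroup on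
`L²_σ`"; here on the Fourier side and for all `p`). [cite: JiaSverak2015, §2 Lemma 2.1] -/
def fourierSimilarityHeatSemigroup (hp : p ≠ ∞) :
    Literature.Analysis.UnboundedOperators.C0Semigroup ℂ (Lp F p (volume : Measure V)) where
  toMonoidHom :=
    { toFun := fun t => fourierSimilarityHeat hp (Multiplicative.toAdd t)
      map_one' := fourierSimilarityHeat_zero hp
      map_mul' := fun s t => by
        rw [toAdd_mul, fourierSimilarityHeat_add] }
  strongly_continuous := fun f =>
    (continuous_fourierSimilarityHeat_apply hp f).comp continuous_toAdd

/-- `T(τ) = M_τ`. [cite: JiaSverak2015, §2 Lemma 2.1] -/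
theorem fourierSimilarityHeatSemigroup_app (hp : p ≠ ∞) (τ : ℝ≥0) :
    (fourierSimilarityHeatSemigroup (V := V) (F := F) hp).app τ = fourierSimilarityHeat hp τ := rfl

/-- **The growth bound in Laplace-bridge form**: `‖T(τ)‖ ≤ 1 · e^{ωτ}` with
`ω = (1 − d)/2 + d/(2p)` (`−¼` on `L²(ℝ³)`), so `C0Semigroup.laplaceResolvent`,
`isPseudoResolvent_laplaceResolvent` (`{Re λ > ω}`) and
`operatorOfResolvent_laplaceResolvent_eq_generator` apply to this semigroup.
[cite: JiaSverak2015, §2 Lemma 2.1] -/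
theorem norm_fourierSimilarityHeatSemigroup_app_le (hp : p ≠ ∞) (τ : ℝ≥0) :
    ‖(fourierSimilarityHeatSemigroup (V := V) (F := F) hp).app τ‖ ≤
      1 * Real.exp (((1 - Module.finrank ℝ V) / 2 + Module.finrank ℝ V / (2 * p.toReal)) * τ) :=
  norm_fourierSimilarityHeat_le hp τ

end Literature.Analysis.OperatorTheory
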